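import Literature.NumberTheory.LFunctions.RiemannSiegelStirlingThirdOrder
import Literature.NumberTheory.LFunctions.ZetaZeroInvSqLimit
import Literature.NumberTheory.LFunctions.ZetaZeroGapsRHExplicitProofs
import Literature.NumberTheory.LFunctions.ZetaZeroSumsLehmanRefined
import Literature.NumberTheory.LFunctions.TuringMethodProofs
import HarnessLib

/-!
# RH-FREE — The consumers of Brent–Platt–Trudgian's Lemma 2 `|Q − S| ≤ 1/(150t)`, with that input DISCHARGED (`BrentPlattTrudgian2021_lemma2_holds`): explicit `|S(T)|` from the `N(T)` facts alone, the BAMS Theorem 2 / Example 1 error terms from the standing condition (2.9) alone, Simonič's printed Lemma 6 («nothing here bears on the truth of RH»)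

Topic `Literature/NumberTheory/LFunctions` (RH literature-typing tranche 1, L4 "explicit zero
statistics", gen 7). Label: **RH-FREE**. THEOREMS only — NO definition, NO new named fact (D-0026):
each statement below is a tree theorem that took `(h : BrentPlattTrudgian2021_lemma2)` as a hypothesis,
with that hypothesis now supplied by the theorem `BrentPlattTrudgian2021_lemma2_holds`
(`RiemannSiegelStirlingThirdOrder.lean`). Nothing here bears on the truth of RH.

* `BrentPlattTrudgian2022_cor1.abs_zetaArgS_le'` — `|S(T)| ≤ 0.28 log T + 1/(150T)` (`T ≥ 2π`) from
  Corollary 1 ALONE; `BrentPlattTrudgian2022_lemma1.abs_zetaArgS_le'` — the Platt–Trudgian form from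
  Lemma 1 alone.
* `BrentPlattTrudgian2021BAMS_lemma2'`, `BrentPlattTrudgian2021BAMS_thm2'`,
  `BrentPlattTrudgian2021_example1_E2'` — the printed error terms `(4.27 + 0.12 log T)/T²`,
  `(8.334 + 0.236 log T)/T³` from the standing condition (2.9) (`BrentPlattTrudgian2021_eq29`) ALONE.
* `Simonic2022Lemma6.printed_bpt'` — Simonič 2022 Lemma 6 exactly as printed, unconditionally in its
  `[BPT21, Lemma 2]` input.
* `BrentPlattTrudgian2021_lemma3_printed'` — the printed error term of BPT 2021 Lemma 3 / Theorems 1, 3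
  (`2(2.067 + 0.059 log T₁)|φ'(T₁)| + (0.059 + 1/150)φ(T₁)/T₁`) from (2.9) alone.
* `BrentPlattTrudgian2021_lemma3_printed_of_gt`, `BrentPlattTrudgian2021_thm1_E2_of_gt` — the same printed
  error terms with NO hypothesis at all for `T₁ > 168π` (Trudgian 2011, Thm. 2.2 = the tree's theorem
  `abs_integral_zetaArgS_le_trudgian_holds`, supplies (2.9) there; computational lane through Trudgian's
  numerics).

## References

* R. P. Brent, D. J. Platt, T. S. Trudgian, Math. Comp. 90 (2021) 2923–2935, Lemma 2, §4 Example 1. [BrentPlattTrudgian2021]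
* R. P. Brent, D. J. Platt, T. S. Trudgian, Bull. Aust. Math. Soc. 104 (2021) 59–65, Lemma 2, Thm 2. [BrentPlattTrudgian2021BAMS]
* R. P. Brent, D. J. Platt, T. S. Trudgian, J. Number Theory 238 (2022) 740–762, Lemma 1, Cor. 1. [BrentPlattTrudgian2022]
* A. Simonič, J. Number Theory 231 (2022) 464–491, Lemma 6. [Simonic2022]
-/

noncomputable section

open Complex Real Set Filter MeasureTheory intervalIntegral

namespace Literature.NumberTheory.LFunctions

open SchoenfeldBound

/-- **`|S(T)| ≤ 0.28 log T + 1/(150T)`** for `T ≥ 2π`, from Brent–Platt–Trudgian 2022, Cor. 1 alone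
(Lemma 2 of the Math. Comp. paper is the theorem `BrentPlattTrudgian2021_lemma2_holds`).
[cite: BrentPlattTrudgian2022, Cor. 1] [cite: BrentPlattTrudgian2021, Lemma 2] -/
theorem BrentPlattTrudgian2022_cor1.abs_zetaArgS_le' (h₁ : BrentPlattTrudgian2022_cor1) {T : ℝ}
    (hT : 2 * π ≤ T) : |zetaArgS T| ≤ 0.28 * Real.log T + 1 / (150 * T) :=
  BrentPlattTrudgian2022_cor1.abs_zetaArgS_le h₁ BrentPlattTrudgian2021_lemma2_holds hT

/-- **`|S(T)| ≤ 0.11 log T + 0.29 log log T + 2.29 + 0.2/T + 1/(150T)`** for `T ≥ 2πe`, from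
Brent–Platt–Trudgian 2022, Lemma 1 (= Platt–Trudgian 2015, Cor. 1) alone.
[cite: BrentPlattTrudgian2022, Lemma 1] [cite: BrentPlattTrudgian2021, Lemma 2] -/
theorem BrentPlattTrudgian2022_lemma1.abs_zetaArgS_le' (h₁ : BrentPlattTrudgian2022_lemma1) {T : ℝ}
    (hT : 2 * π * Real.exp 1 ≤ T) :
    |zetaArgS T| ≤
      0.11 * Real.log T + 0.29 * Real.log (Real.log T) + 2.29 + 0.2 / T + 1 / (150 * T) :=
  BrentPlattTrudgian2022_lemma1.abs_zetaArgS_le h₁ BrentPlattTrudgian2021_lemma2_holds hT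

/-- **BAMS Lemma 2 from (2.9) alone**: `|∫_T^∞ Q/t²| ≤ (4.27 + 0.12 log T)/T²` for `T ≥ 2π`.
[cite: BrentPlattTrudgian2021BAMS, Lemma 2] -/
theorem BrentPlattTrudgian2021BAMS_lemma2' (h29 : BrentPlattTrudgian2021_eq29) {T : ℝ} (hT : 2 * π ≤ T) :
    |∫ t in Ioi T, ((zetaZeroCount t : ℝ) - countMain t) / t ^ 2| ≤
      (4.27 + 0.12 * Real.log T) / T ^ 2 :=
  BrentPlattTrudgian2021BAMS_lemma2 h29 BrentPlattTrudgian2021_lemma2_holds hT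

/-- **BAMS Theorem 2 from (2.9) alone**: for `T ≥ 2π`,
`|H − (Σ_{0<γ≤T} m(ρ)(1/γ − 1/T) − (log²(T/2πe) + 1)/(4π) + 7/(8T))| ≤ (4.27 + 0.12 log T)/T²`
with `H = zetaZeroHarmonicLimit`. [cite: BrentPlattTrudgian2021BAMS, Theorem 2] -/
theorem BrentPlattTrudgian2021BAMS_thm2' (h29 : BrentPlattTrudgian2021_eq29) {T : ℝ} (hT : 2 * π ≤ T) :
    |zetaZeroHarmonicLimit
        - (∑ ρ ∈ zerosBetween 0 T, (riemannZetaZeroOrder ρ : ℝ) * (1 / ρ.im - 1 / T)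
          - (Real.log (T / (2 * π * Real.exp 1)) ^ 2 + 1) / (4 * π) + 7 / (8 * T))| ≤
      (4.27 + 0.12 * Real.log T) / T ^ 2 :=
  BrentPlattTrudgian2021BAMS_thm2 h29 BrentPlattTrudgian2021_lemma2_holds hT

/-- **Example 1's printed error from (2.9) alone**: `|2∫_T^∞ Q/t³| ≤ (8.334 + 0.236 log T)/T³` for
`T ≥ 2π`. [cite: BrentPlattTrudgian2021, §4 Example 1] -/
theorem BrentPlattTrudgian2021_example1_E2' (h29 : BrentPlattTrudgian2021_eq29) {T : ℝ} (hT : 2 * π ≤ T) :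
    |2 * ∫ t in Ioi T, ((zetaZeroCount t : ℝ) - countMain t) / t ^ 3| ≤
      (8.334 + 0.236 * Real.log T) / T ^ 3 :=
  BrentPlattTrudgian2021_example1_E2 h29 BrentPlattTrudgian2021_lemma2_holds hT

/-- **Simonič 2022, Lemma 6 exactly as printed (constant `1/150`)**, now unconditional in its input
`[BPT21, Lemma 2]`: for `T ≥ 2π`, `c₀ > 0` with `2πc₀ < T log(T/2π) log log T`, a bound
`|S(t)| ≤ c₀ log t/log log t` on `[T, ∞)`, and `C` above the printed threshold, some ordinate lies in
`(T, T + C/log log T]`. [cite: Simonic2022, Lemma 6] -/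
theorem Simonic2022Lemma6.printed_bpt' {T c₀ C : ℝ} (hT : 2 * π ≤ T)
    (hc₀ : 0 < c₀) (hpos : 2 * π * c₀ < T * Real.log (T / (2 * π)) * Real.log (Real.log T))
    (hS : ∀ t : ℝ, T ≤ t → |zetaArgS t| ≤ c₀ * Real.log t / Real.log (Real.log t))
    (hC : 4 * π * c₀ * (1 + (1 / 150) * Real.log (Real.log T) / (c₀ * T * Real.log T)) /
        (1 - Real.log (2 * π) / Real.log T - 2 * π * c₀ / (T * Real.log T * Real.log (Real.log T)))
        < C) :
    ∃ m : ℕ, T < zetaOrdinate m ∧ zetaOrdinate m ≤ T + C / Real.log (Real.log T) :=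
  Simonic2022Lemma6.printed_bpt BrentPlattTrudgian2021_lemma2_holds hT hc₀ hpos hS hC

/-- **Brent–Platt–Trudgian 2021, Lemma 3 with the printed constants, from (2.9) alone**: for
`2π ≤ T₁ ≤ T₂`, `φ ∈ C²[T₁,T₂]` with `φ' ≤ 0 ≤ φ''`, `φ(T₂) ≥ 0`, and the standing condition (2.9) on
`[2π, ∞)`,
`|Σ_{T₁<γ≤T₂} m(ρ)φ(γ) − (1/2π)∫φ log(t/2π) − (φ(T₂)Q(T₂) − φ(T₁)Q(T₁))|
  ≤ 2(2.067 + 0.059 log T₁)|φ'(T₁)| + (0.059 + 1/150)φ(T₁)/T₁`.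
[cite: BrentPlattTrudgian2021, Lemma 3 (3.2), Theorem 1 (1.3)] -/
theorem BrentPlattTrudgian2021_lemma3_printed'
    (h29 : ∀ T : ℝ, 2 * π ≤ T → |∫ t in (168 * π)..T, zetaArgS t| ≤ 2.067 + 0.059 * Real.log T)
    {T₁ T₂ : ℝ} (h1 : 2 * π ≤ T₁) (h12 : T₁ ≤ T₂) {φ φ' φ'' : ℝ → ℝ}
    (hφ : ∀ t ∈ Icc T₁ T₂, HasDerivAt φ (φ' t) t) (hφ' : ∀ t ∈ Icc T₁ T₂, HasDerivAt φ' (φ'' t) t)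
    (hφ'' : ContinuousOn φ'' (Icc T₁ T₂)) (hφ'0 : ∀ t ∈ Icc T₁ T₂, φ' t ≤ 0)
    (hφ''0 : ∀ t ∈ Icc T₁ T₂, 0 ≤ φ'' t) (hφT : 0 ≤ φ T₂) :
    |∑ ρ ∈ zerosBetween T₁ T₂, (riemannZetaZeroOrder ρ : ℝ) * φ ρ.im
        - (∫ t in T₁..T₂, φ t * Real.log (t / (2 * π))) / (2 * π)
        - (((zetaZeroCount T₂ : ℝ) - countMain T₂) * φ T₂
            - ((zetaZeroCount T₁ : ℝ) - countMain T₁) * φ T₁)| ≤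
      2 * (2.067 + 0.059 * Real.log T₁) * |φ' T₁| + (0.059 + 1 / 150) * φ T₁ / T₁ :=
  BrentPlattTrudgian2021_lemma3_printed h29 BrentPlattTrudgian2021_lemma2_holds h1 h12 hφ hφ' hφ''
    hφ'0 hφ''0 hφT

/-! ### No hypothesis at all beyond `168π` (Trudgian's `∫S` theorem + Lemma 2) -/

/-- **Brent–Platt–Trudgian 2021, Lemma 3 with the printed constants, UNCONDITIONAL for `T₁ > 168π`**:
for `168π < T₁ ≤ T₂`, `φ ∈ C²[T₁,T₂]` with `φ' ≤ 0 ≤ φ''`, `φ(T₂) ≥ 0`,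
`|Σ_{T₁<γ≤T₂} m(ρ)φ(γ) − (1/2π)∫φ log(t/2π) − (φ(T₂)Q(T₂) − φ(T₁)Q(T₁))|
  ≤ 2(2.067 + 0.059 log T₁)|φ'(T₁)| + (0.059 + 1/150)φ(T₁)/T₁`
(the standing condition (2.9) is Trudgian's theorem there, base point `a = (168π + T₁)/2`; Lemma 2 is
`BrentPlattTrudgian2021_lemma2_holds`). [cite: BrentPlattTrudgian2021, Lemma 3 (3.2), Theorem 1 (1.3)] -/
theorem BrentPlattTrudgian2021_lemma3_printed_of_gt {T₁ T₂ : ℝ} (h1 : 168 * π < T₁) (h12 : T₁ ≤ T₂)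
    {φ φ' φ'' : ℝ → ℝ}
    (hφ : ∀ t ∈ Icc T₁ T₂, HasDerivAt φ (φ' t) t) (hφ' : ∀ t ∈ Icc T₁ T₂, HasDerivAt φ' (φ'' t) t)
    (hφ'' : ContinuousOn φ'' (Icc T₁ T₂)) (hφ'0 : ∀ t ∈ Icc T₁ T₂, φ' t ≤ 0)
    (hφ''0 : ∀ t ∈ Icc T₁ T₂, 0 ≤ φ'' t) (hφT : 0 ≤ φ T₂) :
    |∑ ρ ∈ zerosBetween T₁ T₂, (riemannZetaZeroOrder ρ : ℝ) * φ ρ.im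
        - (∫ t in T₁..T₂, φ t * Real.log (t / (2 * π))) / (2 * π)
        - (((zetaZeroCount T₂ : ℝ) - countMain T₂) * φ T₂
            - ((zetaZeroCount T₁ : ℝ) - countMain T₁) * φ T₁)| ≤
      2 * (2.067 + 0.059 * Real.log T₁) * |φ' T₁| + (0.059 + 1 / 150) * φ T₁ / T₁ := by
  have hπ : 3 < π := Real.pi_gt_three
  have h0 : 0 < T₁ := by nlinarith
  set a : ℝ := (168 * π + T₁) / 2 with ha
  have ha1 : 168 * π < a := by rw [ha]; linarith
  have ha2 : a < T₁ := by rw [ha]; linarith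
  have hS1 : ∀ t ∈ Icc T₁ T₂, |∫ x in a..t, zetaArgS x| ≤ 2.067 + 0.059 * Real.log t :=
    fun t ht ↦ abs_integral_zetaArgS_le_trudgian_holds ha1 (ha2.trans_le ht.1)
  have hQS : ∀ t ∈ Icc T₁ T₂, |((zetaZeroCount t : ℝ) - countMain t) - zetaArgS t| ≤ (1 / 150) / t := by
    intro t ht
    have h := BrentPlattTrudgian2021_lemma2_holds t (by linarith [ht.1])
    rwa [div_div]
  exact BrentPlattTrudgian2021_lemma3 h0 h12 (by norm_num) hφ hφ' hφ'' hφ'0 hφ''0 hφT hS1 hQS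

/-- **Brent–Platt–Trudgian 2021, Theorem 1 eq. (1.3), UNCONDITIONAL for `T₁ > 168π`**: for
`φ ∈ C²[T₁,∞)` with `φ ≥ 0`, `φ' ≤ 0 ≤ φ''`, `∫_{T₁}^∞ φ/t < ∞`,
`|E₂(T₁)| = |∫_{T₁}^∞ φ'Q| ≤ 2(2.067 + 0.059 log T₁)|φ'(T₁)| + (0.059 + 1/150)φ(T₁)/T₁`.
[cite: BrentPlattTrudgian2021, Theorem 1 eq. (1.3)] -/
theorem BrentPlattTrudgian2021_thm1_E2_of_gt {T₁ : ℝ} (h1 : 168 * π < T₁) {φ φ' φ'' : ℝ → ℝ}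
    (hφ : ∀ t ∈ Ici T₁, HasDerivAt φ (φ' t) t) (hφ' : ∀ t ∈ Ici T₁, HasDerivAt φ' (φ'' t) t)
    (hφ'' : ContinuousOn φ'' (Ici T₁)) (hφ0 : ∀ t ∈ Ici T₁, 0 ≤ φ t)
    (hφ'0 : ∀ t ∈ Ici T₁, φ' t ≤ 0) (hφ''0 : ∀ t ∈ Ici T₁, 0 ≤ φ'' t)
    (hint : IntegrableOn (fun t ↦ φ t / t) (Ioi T₁)) :
    |∫ t in Ioi T₁, ((zetaZeroCount t : ℝ) - countMain t) * φ' t| ≤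
      2 * (2.067 + 0.059 * Real.log T₁) * |φ' T₁| + (0.059 + 1 / 150) * φ T₁ / T₁ := by
  have hπ : 3 < π := Real.pi_gt_three
  have h3 : (3 : ℝ) ≤ T₁ := by nlinarith
  set a : ℝ := (168 * π + T₁) / 2 with ha
  have ha1 : 168 * π < a := by rw [ha]; linarith
  have ha2 : a < T₁ := by rw [ha]; linarith
  have hS1 : ∀ t ∈ Ici T₁, |∫ x in a..t, zetaArgS x| ≤ 2.067 + 0.059 * Real.log t :=
    fun t ht ↦ abs_integral_zetaArgS_le_trudgian_holds ha1 (ha2.trans_le ht)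
  have hQS : ∀ t ∈ Ici T₁, |((zetaZeroCount t : ℝ) - countMain t) - zetaArgS t| ≤ (1 / 150) / t := by
    intro t ht
    have ht' : T₁ ≤ t := ht
    have h := BrentPlattTrudgian2021_lemma2_holds t (by linarith)
    rwa [div_div]
  exact BrentPlattTrudgian2021_thm1_E2 h3 (by norm_num) hφ hφ' hφ'' hφ0 hφ'0 hφ''0 hint hS1 hQS

end Literature.NumberTheory.LFunctions
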